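import Mathlib

/-!
# C4 — the pair class `2α₁` : certificates (cell hsemireg-c4-1, gen 31)

Companion plate to `C4-PAIR-CLASS-c4-1-g31.md` (crux `BlochSeedDiscOne`, R2-Q4 residual row `(r,m)=(2,0)`).
Mathlib-only; no `sorry`, no `instance`, no `notation`, no banned options.

NOTHING here is proved toward HC / HC_CM / HC_AV / №4 / 26512 / 18881 / H2: these are the
elementary algebraic identities and LP-duality certificates used by the memo
(evidence and typed checks, not rungs).

Dictionary.  On a ppav `(X, θ)` of dimension 4 write Chern characters in the basis
`θ^k / k!`; a class `Σ_k M_k θ^k/k!` is recorded by its *moment vector* `(M_0,…,M_4)`.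
A simple semihomogeneous bundle of slope `p/q` has `ch = q^4 · e^{(p/q)θ}`, i.e. moments
`q^{4-k} p^k`; the pair class `2α₁·e^{cθ} = e^{(c+i)θ} + e^{(c-i)θ}` has moments
`M_k(c) = (c+i)^k + (c-i)^k` (§1).  The functional `L_c(f) = f(c+i) + f(c-i)` on polynomials of
degree ≤ 4 is `Σ a_k M_k(c)` (§1, `L`).  A signed design `Σ_u w_u δ_u` realises the pair class iff
`Σ_u w_u u^k = M_k(c)` for `k ≤ 4`; then `Σ_u w_u f(u) = L_c(f)` for every `f` of degree ≤ 4.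
-/

namespace HsemiregC4.PairClass

open Complex in
/-- §1. `M_k(c) = (c+i)^k + (c-i)^k`, k = 0..4, certified over `ℂ`. -/
theorem moments_pair (c : ℂ) :
    (c + I) ^ 0 + (c - I) ^ 0 = 2 ∧
    (c + I) ^ 1 + (c - I) ^ 1 = 2 * c ∧
    (c + I) ^ 2 + (c - I) ^ 2 = 2 * (c ^ 2 - 1) ∧
    (c + I) ^ 3 + (c - I) ^ 3 = 2 * (c ^ 3 - 3 * c) ∧
    (c + I) ^ 4 + (c - I) ^ 4 = 2 * (c ^ 4 - 6 * c ^ 2 + 1) := by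
  refine ⟨by ring, by ring, ?_, ?_, ?_⟩
  · linear_combination 2 * I_sq
  · linear_combination (6 * c) * I_sq
  · linear_combination (12 * c ^ 2 + 2 * I ^ 2 - 2) * I_sq

/-- The moment polynomials of the pair class `2α₁ e^{cθ}` (rational form). -/
def M0 (_c : ℚ) : ℚ := 2
/-- `M_1(c) = 2c`. -/
def M1 (c : ℚ) : ℚ := 2 * c
/-- `M_2(c) = 2(c²-1)`. -/
def M2 (c : ℚ) : ℚ := 2 * (c ^ 2 - 1)
/-- `M_3(c) = 2(c³-3c)`. -/
def M3 (c : ℚ) : ℚ := 2 * (c ^ 3 - 3 * c)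
/-- `M_4(c) = 2(c⁴-6c²+1)`. -/
def M4 (c : ℚ) : ℚ := 2 * (c ^ 4 - 6 * c ^ 2 + 1)

/-- The recursion of `(c ± i)^k` (characteristic polynomial `t² - 2ct + (c²+1)`), as a check
that `M2, M3, M4` are the pair moments. -/
theorem moments_recursion (c : ℚ) :
    M2 c = 2 * c * M1 c - (c ^ 2 + 1) * M0 c ∧
    M3 c = 2 * c * M2 c - (c ^ 2 + 1) * M1 c ∧
    M4 c = 2 * c * M3 c - (c ^ 2 + 1) * M2 c := by
  unfold M0 M1 M2 M3 M4; exact ⟨by ring, by ring, by ring⟩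

/-- rank-2 identity: for `c = 0` the moments are `(2,0,-2,0,2)`, i.e. `ch = 2 - θ² + θ⁴/12`,
which for rank 2, `c₁ = 0` is exactly `c(E) = 1 + θ²` (`ch₂=-c₂`, `ch₃=c₃/2`, `ch₄=(c₂²-2c₄)/12`). -/
theorem moments_at_zero : M0 0 = 2 ∧ M1 0 = 0 ∧ M2 0 = -2 ∧ M3 0 = 0 ∧ M4 0 = 2 := by
  unfold M0 M1 M2 M3 M4; norm_num

/-- `ch₄ = (c₂² - 2c₄)/12` with `c₂ = θ²`, `c₄ = 0`: in the `θ^k/k!` basis `c₂² = θ⁴` has coordinate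
`4! = 24`, so the `θ⁴/4!`-coordinate of `ch₄` is `(24 - 0)/12 = 2 = M₄(0)` — the arithmetic fact used. -/
theorem ch4_of_rank_two : ((24 : ℚ) - 2 * 0) / 12 = M4 0 := by unfold M4; norm_num

/-- §1'. The functional `L_c` on a degree-≤4 polynomial with coefficients `a0..a4`. -/
def L (c a0 a1 a2 a3 a4 : ℚ) : ℚ :=
  a0 * M0 c + a1 * M1 c + a2 * M2 c + a3 * M3 c + a4 * M4 c

/-! ## §2. Integrality lattice residues (functional (iii) = `M₄ - M₂ - 2(M₃ - M₁)` mod 24) -/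

/-- residue (iii) of the pair class `2α₁ e^{cθ}` is `4` for every integer twist `c`. -/
theorem residue_pair : ∀ c : ZMod 24,
    2 * (c ^ 4 - 6 * c ^ 2 + 1) - 2 * (c ^ 2 - 1) - 2 * (2 * (c ^ 3 - 3 * c) - 2 * c) = 4 := by
  decide

/-- residue (iii) of a simple semihomogeneous piece of slope `p/q` (moments `q^{4-k} p^k`) is
`p(p-q)(p+q)(p-2q)`; integer slopes (`q=1`) give `0`. -/
theorem residue_q1 : ∀ p : ZMod 24, p * (p - 1) * (p + 1) * (p - 2) = 0 := by decide
/-- half-integer slopes (`q = 2`, `p` odd) give `9`. -/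
theorem residue_q2 : ∀ k : ZMod 24,
    (2 * k + 1) * ((2 * k + 1) - 2) * ((2 * k + 1) + 2) * ((2 * k + 1) - 4) = 9 := by decide
/-- third-integer slopes (`q = 3`, `3 ∤ p`) give `16`. -/
theorem residue_q3 : ∀ k : ZMod 24,
    (3 * k + 1) * ((3 * k + 1) - 3) * ((3 * k + 1) + 3) * ((3 * k + 1) - 6) = 16 ∧
    (3 * k + 2) * ((3 * k + 2) - 3) * ((3 * k + 2) + 3) * ((3 * k + 2) - 6) = 16 := by decide
/-- quarter slopes (`q = 4`, `p` odd) give `9`; sixth slopes (`q = 6`, `gcd(p,6)=1`) give `1`. -/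
theorem residue_q4_q6 : ∀ k : ZMod 24,
    (2 * k + 1) * ((2 * k + 1) - 4) * ((2 * k + 1) + 4) * ((2 * k + 1) - 8) = 9 ∧
    (6 * k + 1) * ((6 * k + 1) - 6) * ((6 * k + 1) + 6) * ((6 * k + 1) - 12) = 1 ∧
    (6 * k + 5) * ((6 * k + 5) - 6) * ((6 * k + 5) + 6) * ((6 * k + 5) - 12) = 1 := by decide

/-- With pieces of `q ≤ 3` only (net signed counts: `x` half-slope pieces, `y` third-slope pieces)
the residue equation `9x + 16y ≡ 4 (mod 24)` forces `x ≡ 4 (mod 8)` and `y ≡ 1 (mod 3)`. -/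
theorem residue_split (x y : ℤ) (h : (9 * x + 16 * y) % 24 = 4) : x % 8 = 4 ∧ y % 3 = 1 := by
  omega

/-- … hence at least FOUR half-slope pieces (rank 16 each) and at least ONE third-slope piece
(rank 81): the integrality floor `64 ∣∣ 81` used in the memo (§5). -/
theorem integrality_floor (a b u v : ℕ) (hx : ((a : ℤ) - b) % 8 = 4) (hy : ((u : ℤ) - v) % 3 = 1) :
    4 ≤ a + b ∧ 1 ≤ u + v := by
  omega

/-! ## §3. NO-GO for ≤ 3 slope-sorted sign runs (Theorem 2 of the memo)

Test functions: `f = (s-b)(s-l)²` (2 runs, threshold `b`), `g = (s-b₁)(s-b₂)(s-l)²` (3 runs).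
A realising design gives `Σ w_u f(u) = L_c(f)` with every term `w_u f(u) ≥ 0` (resp. `≤ 0`),
so `L_c(±f) ≥ 0`; the certificates below exhibit `l` with the wrong sign. -/

/-- coefficient expansion of `(s-b)(s-l)²` (checked by `ring`). -/
theorem expand_two (s b l : ℚ) :
    (s - b) * (s - l) ^ 2 = (-b * l ^ 2) + (l ^ 2 + 2 * b * l) * s + (-(b + 2 * l)) * s ^ 2
      + 1 * s ^ 3 + 0 * s ^ 4 := by ring

/-- `L_c((s-b)(s-l)²) = 2·[x(y²-1) - 2y]`, `x = c-b`, `y = c-l`. -/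
theorem L_two (c b l : ℚ) :
    L c (-b * l ^ 2) (l ^ 2 + 2 * b * l) (-(b + 2 * l)) 1 0
      = 2 * ((c - b) * ((c - l) ^ 2 - 1) - 2 * (c - l)) := by
  unfold L M0 M1 M2 M3 M4; ring

/-- 2-run certificate: `l = c - 1` gives `L_c(f) = -4 < 0` and `l = c + 1` gives `L_c(-f) = -4 < 0`,
for EVERY threshold `b` and every twist `c` — so neither sign pattern `(+,-)` nor `(-,+)` is
realisable: no 2-term presentation / separated-slope resolution of length 1. -/
theorem two_runs_nogo (c b : ℚ) :
    L c (-b * (c - 1) ^ 2) ((c - 1) ^ 2 + 2 * b * (c - 1)) (-(b + 2 * (c - 1))) 1 0 = -4 ∧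
    -(L c (-b * (c + 1) ^ 2) ((c + 1) ^ 2 + 2 * b * (c + 1)) (-(b + 2 * (c + 1))) 1 0) = -4 := by
  unfold L M0 M1 M2 M3 M4; constructor <;> ring

/-- coefficient expansion of `(s-b₁)(s-b₂)(s-l)²`. -/
theorem expand_three (s b₁ b₂ l : ℚ) :
    (s - b₁) * (s - b₂) * (s - l) ^ 2
      = (b₁ * b₂ * l ^ 2) + (-(l ^ 2 * (b₁ + b₂) + 2 * l * b₁ * b₂)) * s
        + (l ^ 2 + 2 * l * (b₁ + b₂) + b₁ * b₂) * s ^ 2 + (-(2 * l + b₁ + b₂)) * s ^ 3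
        + 1 * s ^ 4 := by ring

/-- the 3-run kernel `h(x₁,x₂;y) = (x₁x₂-1)(y²-1) - 2y(x₁+x₂)`. -/
def h3 (x₁ x₂ y : ℚ) : ℚ := (x₁ * x₂ - 1) * (y ^ 2 - 1) - 2 * y * (x₁ + x₂)

/-- `L_c((s-b₁)(s-b₂)(s-l)²) = 2·h(c-b₁, c-b₂; c-l)`. -/
theorem L_three (c b₁ b₂ l : ℚ) :
    L c (b₁ * b₂ * l ^ 2) (-(l ^ 2 * (b₁ + b₂) + 2 * l * b₁ * b₂))
        (l ^ 2 + 2 * l * (b₁ + b₂) + b₁ * b₂) (-(2 * l + b₁ + b₂)) 1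
      = 2 * h3 (c - b₁) (c - b₂) (c - l) := by
  unfold L M0 M1 M2 M3 M4 h3; ring

/-- 3-run certificate: for ALL thresholds, `h` takes both signs in `y`; hence `L_c(g) < 0` for
some `l` and `L_c(-g) < 0` for some `l` — neither `(+,-,+)` nor `(-,+,-)` is realisable:
no separated-slope 3-term monad and no separated resolution of length 2. -/
theorem three_runs_nogo (x₁ x₂ : ℚ) : (∃ y, h3 x₁ x₂ y < 0) ∧ (∃ y, 0 < h3 x₁ x₂ y) := by
  rcases lt_trichotomy (x₁ + x₂) 0 with hS | hS | hS
  · exact ⟨⟨-1, by unfold h3; nlinarith⟩, ⟨1, by unfold h3; nlinarith⟩⟩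
  · have hx : x₂ = -x₁ := by linarith
    subst hx
    exact ⟨⟨2, by unfold h3; nlinarith [sq_nonneg x₁]⟩, ⟨0, by unfold h3; nlinarith [sq_nonneg x₁]⟩⟩
  · exact ⟨⟨1, by unfold h3; nlinarith⟩, ⟨-1, by unfold h3; nlinarith⟩⟩

/-! ## §4. Four runs: gap-root test functions and the LP-duality mass certificate (Theorem 3) -/

/-- `L_c(-(s-r₁)(s-r₂)(s-r₃)) = 2(e₃ - e₁)(r - c)`: the cubic interval condition `e₃ ≥ e₁` over
admissible gap roots (necessary for the pattern `(+,-,+,-)`). -/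
theorem L_cubic (c r₁ r₂ r₃ : ℚ) :
    L c (r₁ * r₂ * r₃) (-(r₁ * r₂ + r₁ * r₃ + r₂ * r₃)) (r₁ + r₂ + r₃) (-1) 0
      = 2 * ((r₁ - c) * (r₂ - c) * (r₃ - c) - ((r₁ - c) + (r₂ - c) + (r₃ - c))) := by
  unfold L M0 M1 M2 M3 M4; ring

/-- expansion check for the cubic. -/
theorem expand_cubic (s r₁ r₂ r₃ : ℚ) :
    -((s - r₁) * (s - r₂) * (s - r₃)) = (r₁ * r₂ * r₃) + (-(r₁ * r₂ + r₁ * r₃ + r₂ * r₃)) * s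
      + (r₁ + r₂ + r₃) * s ^ 2 + (-1) * s ^ 3 + 0 * s ^ 4 := by ring

/-- `L_c(-(s-r₁)(s-r₂)(s-r₃)(s-r₄)) = 2(e₂ - e₄ - 1)(r - c)`: the quartic behind the optimal
dual for the outer-band mass (memo Thm 3). -/
theorem L_quartic (c r₁ r₂ r₃ r₄ : ℚ) :
    L c (-(r₁ * r₂ * r₃ * r₄)) (r₁ * r₂ * r₃ + r₁ * r₂ * r₄ + r₁ * r₃ * r₄ + r₂ * r₃ * r₄)
        (-(r₁ * r₂ + r₁ * r₃ + r₁ * r₄ + r₂ * r₃ + r₂ * r₄ + r₃ * r₄)) (r₁ + r₂ + r₃ + r₄) (-1)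
      = 2 * (((r₁ - c) * (r₂ - c) + (r₁ - c) * (r₃ - c) + (r₁ - c) * (r₄ - c) + (r₂ - c) * (r₃ - c)
              + (r₂ - c) * (r₄ - c) + (r₃ - c) * (r₄ - c))
            - (r₁ - c) * (r₂ - c) * (r₃ - c) * (r₄ - c) - 1) := by
  unfold L M0 M1 M2 M3 M4; ring

/-- expansion check for the quartic. -/
theorem expand_quartic (s r₁ r₂ r₃ r₄ : ℚ) :
    -((s - r₁) * (s - r₂) * (s - r₃) * (s - r₄))
      = (-(r₁ * r₂ * r₃ * r₄)) + (r₁ * r₂ * r₃ + r₁ * r₂ * r₄ + r₁ * r₃ * r₄ + r₂ * r₃ * r₄) * s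
        + (-(r₁ * r₂ + r₁ * r₃ + r₁ * r₄ + r₂ * r₃ + r₂ * r₄ + r₃ * r₄)) * s ^ 2
        + (r₁ + r₂ + r₃ + r₄) * s ^ 3 + (-1) * s ^ 4 := by ring

/-- THEOREM 3 (abstract LP-duality certificate).  If every term `w i * f i` is `≥ 0` on the node
set `s` and on the sub-band `D ⊆ s` the test function is `≤ -1` while the masses are `≤ 0`,
then the rank carried by `D` is at most `Σ_s w i * f i` (`= L_c(f)` for a realising design). -/
theorem outer_band_mass_le {ι : Type*} (s D : Finset ι) (hD : D ⊆ s) (w f : ι → ℚ)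
    (hpos : ∀ i ∈ s, 0 ≤ w i * f i) (hf : ∀ i ∈ D, f i ≤ -1) (hw : ∀ i ∈ D, w i ≤ 0) :
    ∑ i ∈ D, (-w i) ≤ ∑ i ∈ s, w i * f i := by
  calc ∑ i ∈ D, (-w i) ≤ ∑ i ∈ D, w i * f i := by
        apply Finset.sum_le_sum
        intro i hi
        have h1 := hf i hi
        have h2 := hw i hi
        nlinarith
    _ ≤ ∑ i ∈ s, w i * f i :=
        Finset.sum_le_sum_of_subset_of_nonneg hD (fun i hi _ => hpos i hi)

/-- COROLLARY (the `ρ`-factor): for a root `r ≤ 0` and the binding node `D > 1` (twist `c = 0`),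
`|r - i|² = 1 + r² < (D - r)²`, i.e. each such root contributes a factor `< 1` to the certificate;
with all three finite roots `≤ 0` (the case `max C' ≤ c`) the bound is `< 2 ≤ rk D' - 1`. -/
theorem rho_lt_one (r D : ℚ) (hr : r ≤ 0) (hD : 1 < D) : 1 + r ^ 2 < (D - r) ^ 2 := by
  nlinarith

/-- Real (non-integral) feasibility of the anchored 4-run shape: the 4-atom signed measure
`(+10/63)δ_{-7/2} + (-106/99)δ_{-2} + (+53/18)δ_{-1/2} + (-5/154)δ_{7/2}` has EXACTLY the pair
moments `(2,0,-2,0,2)` — so for 4 runs the obstruction is mass/integrality, not moments. -/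
theorem shapeK_real_vertex :
    let w₁ : ℚ := 10 / 63;  let u₁ : ℚ := -7 / 2
    let w₂ : ℚ := -106 / 99; let u₂ : ℚ := -2
    let w₃ : ℚ := 53 / 18;  let u₃ : ℚ := -1 / 2
    let w₄ : ℚ := -5 / 154; let u₄ : ℚ := 7 / 2
    w₁ + w₂ + w₃ + w₄ = 2 ∧
    w₁ * u₁ + w₂ * u₂ + w₃ * u₃ + w₄ * u₄ = 0 ∧
    w₁ * u₁ ^ 2 + w₂ * u₂ ^ 2 + w₃ * u₃ ^ 2 + w₄ * u₄ ^ 2 = -2 ∧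
    w₁ * u₁ ^ 3 + w₂ * u₂ ^ 3 + w₃ * u₃ ^ 3 + w₄ * u₄ ^ 3 = 0 ∧
    w₁ * u₁ ^ 4 + w₂ * u₂ ^ 4 + w₃ * u₃ ^ 4 + w₄ * u₄ ^ 4 = 2 := by
  norm_num

/-- The optimal dual quartic for `mass(D')` in geometry G2 of the memo (roots `-4,-2,-2/3,1/2`,
binding node `3/2`, `c = 0`): certificate value `2(e₂-e₄-1)/∏(3/2 - root) = 496/1001 < 1` (= the exact LP maximum found by `maxmass.py`),
so band `D'` of G2 cannot hold a single line bundle (it needs rank ≥ 3). -/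
theorem G2_outer_certificate :
    let r₁ : ℚ := -4; let r₂ : ℚ := -2; let r₃ : ℚ := -2 / 3; let r₄ : ℚ := 1 / 2; let D : ℚ := 3 / 2
    2 * ((r₁ * r₂ + r₁ * r₃ + r₁ * r₄ + r₂ * r₃ + r₂ * r₄ + r₃ * r₄) - r₁ * r₂ * r₃ * r₄ - 1)
      / ((D - r₁) * (D - r₂) * (D - r₃) * (D - r₄)) = 496 / 1001 := by
  norm_num

/-! ## §5. Planted-false controls (the checker is not vacuous) -/

/-- NEG control 1: the half-slope residue is `9`, not `16`. -/
example : ¬ (∀ k : ZMod 24,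
    (2 * k + 1) * ((2 * k + 1) - 2) * ((2 * k + 1) + 2) * ((2 * k + 1) - 4) = 16) := by decide

/-- NEG control 2: the 2-run certificate value is `-4`, not `0`. -/
example : ¬ (∀ c b : ℚ,
    L c (-b * (c - 1) ^ 2) ((c - 1) ^ 2 + 2 * b * (c - 1)) (-(b + 2 * (c - 1))) 1 0 = 0) := by
  intro hall
  have h0 := hall 0 0
  have h1 := (two_runs_nogo 0 0).1
  rw [h0] at h1
  norm_num at h1

end HsemiregC4.PairClass
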